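import Summits.MatrixMultiplication.OmegaCensus.SmallFormats.MatMul22nRankGF7Slack3Cert
import HarnessLib

/-!
# ω-census family (a): counting identities of the `𝔽₇` X-cap rows (kernel checks + sound forms) for the slack-3 argument

Cell `pub-omega` (unit `pub-omega-tensor-g13`), topic `Summits/MatrixMultiplication/OmegaCensus` (sub-folder `SmallFormats`).
Framing (verbatim): lottery ticket; floor = certified bounds/negative ranges. HONEST FRAMING: bookkeeping, no bound, nothing on `ω`.
Each identity is ONE kernel-checked equality of packed vectors (`MatMul22nRankGF7Slack3Cert.wvec7` / `pack24_inj`) followed by its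
meaning for an arbitrary point `x : ℕ → ℕ` (row sums `xrs7 x r` over the tree's `rowList7`):
* `rowList7_sub_capCol7`, `capRow_eq_xrs7`: the tree's column table and row lists describe the same rows (double counting of the
  `10192` memberships against the tree's inclusion `capCol7_sub_rowList7`), so the cap rows of `xcapSys7s` evaluate to `xrs7 x r + x 400`;
* `tight_count7`: `Σ_{tangent} xrs + 2·Σ_{row-plane} xrs = 8·Σ_{j<400} x j` (every class is on 8 tangent rows, or on 6 and one row-plane row);
* `cell_sum7`: the six tangent rows through the rank-one class `p7 w i` carry exactly the invertible classes `g` with `perm7 g i = w`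
  (once each) and `p7 w i` (six times);
* `ruling_sum7`, `rankOne_sum7`: row-plane row `1266 + w` is `{p7 w i : i < 8}`, and the rank-one classes are exactly the 64 `p7 w i`;
* `rect_parity7`: 49 `𝔽₂`-certificates — every 2 × 2 'rectangle' of cells is, modulo 2, a sum of graphs of invertible classes — so
  evenness of all graph sums `Σ_i f (perm7 g i) i` forces rectangle parity of `f` (input of `MatMul22nRankGF7Slack3ParityBound`).
-/

namespace Summit.MatrixMultiplication.OmegaCensus.SmallFormats

open Finset
open Literature.NumberTheory.NumberFields (list_sum_range_map)

/-! ## Row lists versus the column table (the inclusion missing from the tree, by double counting) -/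

set_option maxRecDepth 100000 in
/-- The column table has `10192 = 1274 · 8` memberships in total. -/
theorem capCol7_total_length : (((List.range 400).map fun j => (capCol7 j).length).sum) = 10192 := by decide +kernel

/-- Counting the rows of a class inside `range 1274` gives the length of its column. -/
theorem sum_ind_capCol7 (j : ℕ) :
    ∑ r ∈ range 1274, (if r ∈ capCol7 j then 1 else 0) = (capCol7 j).length := by
  classical
  rw [← sum_filter, sum_const, smul_eq_mul, mul_one]
  have hset : (range 1274).filter (fun r => r ∈ capCol7 j) = (capCol7 j).toFinset := by
    ext r
    simp only [mem_filter, mem_range, List.mem_toFinset]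
    exact ⟨fun h => h.2, fun h => ⟨lt_of_mem_capCol7 h, h⟩⟩
  rw [hset, List.toFinset_card_of_nodup (capCol7_nodup' j)]

/-- The classes `j < 400` whose column lists row `r` are among the eight classes of `rowList7 r`. -/
theorem filter_capCol7_sub_rowList7 (r : ℕ) :
    (range 400).filter (fun j => r ∈ capCol7 j) ⊆ (rowList7 r).toFinset := by
  intro j hj
  rw [mem_filter, mem_range] at hj
  exact List.mem_toFinset.2 (capCol7_sub_rowList7 hj.1 hj.2)

/-- … hence there are at most `8` of them. -/
theorem card_filter_capCol7_le (r : ℕ) : ((range 400).filter (fun j => r ∈ capCol7 j)).card ≤ 8 := by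
  classical
  refine le_trans (card_le_card (filter_capCol7_sub_rowList7 r)) ?_
  exact le_trans (List.toFinset_card_le _) (by rw [rowList7_length])

/-- … and exactly `8` of them (double counting the `10192` memberships). -/
theorem card_filter_capCol7_eq {r : ℕ} (hr : r < 1274) : ((range 400).filter (fun j => r ∈ capCol7 j)).card = 8 := by
  classical
  have htot : ∑ r ∈ range 1274, ((range 400).filter (fun j => r ∈ capCol7 j)).card = ∑ r ∈ range 1274, 8 := by
    have h1 : ∀ r ∈ range 1274, ((range 400).filter (fun j => r ∈ capCol7 j)).card
        = ∑ j ∈ range 400, (if r ∈ capCol7 j then 1 else 0) := by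
      intro r _; rw [← sum_filter, sum_const, smul_eq_mul, mul_one]
    rw [sum_congr rfl h1, sum_comm]
    rw [sum_congr rfl fun j _ => sum_ind_capCol7 j]
    rw [← list_sum_range_map, capCol7_total_length]
    simp
  have := (sum_eq_sum_iff_of_le (fun r _ => card_filter_capCol7_le r)).1 htot
  exact this r (mem_range.2 hr)

/-- **Row lists ⊆ column table**: `r < 1274`, `j ∈ rowList7 r ⇒ r ∈ capCol7 j` (the tree proves the other inclusion,
`capCol7_sub_rowList7`). -/
theorem rowList7_sub_capCol7 {r : ℕ} (hr : r < 1274) {j : ℕ} (hj : j ∈ rowList7 r) : r ∈ capCol7 j := by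
  classical
  have hEq : (range 400).filter (fun j => r ∈ capCol7 j) = (rowList7 r).toFinset :=
    eq_of_subset_of_card_le (filter_capCol7_sub_rowList7 r)
      (by rw [card_filter_capCol7_eq hr]; exact le_trans (List.toFinset_card_le _) (by rw [rowList7_length]))
  have hmem : j ∈ (range 400).filter (fun j => r ∈ capCol7 j) := by rw [hEq]; exact List.mem_toFinset.2 hj
  exact (mem_filter.1 hmem).2

/-- **The cap rows of `xcapSys7s` are the row-list sums.** For `r < 1274`:
`Σ_{j<401} [r ∈ capCol7 j]·x j = xrs7 x r + x 400`. -/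
theorem capRow_eq_xrs7 (x : ℕ → ℕ) {r : ℕ} (hr : r < 1274) :
    ∑ j ∈ range 401, (if r ∈ capCol7 j then (1 : ℤ) else 0) * (x j : ℤ) = xrs7 x r + (x 400 : ℤ) := by
  have hz : (if r ∈ capCol7 400 then (1 : ℤ) else 0) * (x 400 : ℤ) = (x 400 : ℤ) := by
    rw [if_pos (by simp [capCol7, hr]), one_mul]
  have hnd := (rowList7_ok ⟨r, hr⟩).1
  have hlt := (rowList7_ok ⟨r, hr⟩).2
  have h400 : ∑ j ∈ range 400, (if r ∈ capCol7 j then (1 : ℤ) else 0) * (x j : ℤ) = xrs7 x r := by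
    unfold xrs7
    calc ∑ j ∈ range 400, (if r ∈ capCol7 j then (1 : ℤ) else 0) * (x j : ℤ)
        = ∑ j ∈ range 400, (if j ∈ rowList7 r then (x j : ℤ) else 0) := by
          refine sum_congr rfl fun j hj => ?_
          by_cases h : r ∈ capCol7 j
          · rw [if_pos h, one_mul, if_pos (capCol7_sub_rowList7 (mem_range.1 hj) h)]
          · rw [if_neg h, zero_mul, if_neg (fun h' => h (rowList7_sub_capCol7 hr h'))]
      _ = ∑ j ∈ (rowList7 r).toFinset, (x j : ℤ) := by
          rw [← sum_filter]
          refine sum_congr ?_ fun _ _ => rfl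
          ext j
          simp only [mem_filter, mem_range, List.mem_toFinset]
          exact ⟨fun h => h.2, fun h => ⟨hlt j h, h⟩⟩
      _ = ((rowList7 r).map fun j => (x j : ℤ)).sum := by rw [List.sum_toFinset _ hnd]
  rw [sum_range_succ, h400, hz]

/-! ## Tightness counting: tangent + 2·row-plane incidences -/

set_option maxRecDepth 100000 in
set_option maxHeartbeats 4000000 in
/-- Packed check: every class `j < 400` has `#tangent rows + 2·#row-plane rows = 8`. -/
theorem tightVec7_ok :
    wvec7 (fun r => if r < 384 then 1 else if 1266 ≤ r then 2 else 0) = 8 * ((List.range 400).map fun j => 2 ^ (24 * j)).sum := by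
  decide +kernel

/-- **Tightness counting identity.** `Σ_{r<384} xrs7 x r + 2·Σ_{k<8} xrs7 x (1266+k) = 8·Σ_{j<400} x j`. -/
theorem tight_count7 (x : ℕ → ℕ) :
    ∑ r ∈ range 384, xrs7 x r + 2 * ∑ k ∈ range 8, xrs7 x (1266 + k) = 8 * ∑ j ∈ range 400, (x j : ℤ) := by
  set w : ℕ → ℕ := fun r => if r < 384 then 1 else if 1266 ≤ r then 2 else 0 with hw
  have hall : ((List.range 400).map fun j => 2 ^ (24 * j)).sum = pack24 (fun _ => 1) 400 := by
    unfold pack24; rw [list_sum_range_map]; exact sum_congr rfl fun j _ => (one_mul _).symm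
  have hpk : pack24 (wcoef7 w) 400 = pack24 (fun _ => 8 * 1) 400 := by
    rw [← wvec7_eq_pack24, pack24_smul, ← hall]; exact tightVec7_ok
  have hwle : ∀ r, w r ≤ 2 := fun r => by simp only [hw]; split_ifs <;> omega
  have hcoef : ∀ j < 400, wcoef7 w j = 8 := fun j hj =>
    pack24_inj (fun i _ => lt_of_le_of_lt (wcoef7_le hwle i) (by norm_num)) (fun _ _ => by norm_num) hpk hj
  have h2 : ∑ j ∈ range 400, (wcoef7 w j : ℤ) * (x j : ℤ) = 8 * ∑ j ∈ range 400, (x j : ℤ) := by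
    rw [mul_sum]
    refine sum_congr rfl fun j hj => ?_
    rw [hcoef j (mem_range.1 hj)]; push_cast; ring
  have h := (sum_w_xrs7 w x).trans h2
  rw [← h, show (1274 : ℕ) = 384 + 890 from rfl, sum_range_add, show (890 : ℕ) = 882 + 8 from rfl, sum_range_add]
  have e1 : ∀ r ∈ range 384, (w r : ℤ) * xrs7 x r = xrs7 x r := fun r hr => by
    simp only [hw, if_pos (mem_range.1 hr)]; push_cast; ring
  have e2 : ∀ k ∈ range 882, (w (384 + k) : ℤ) * xrs7 x (384 + k) = 0 := fun k hk => by
    have := mem_range.1 hk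
    simp only [hw, if_neg (by omega : ¬ 384 + k < 384), if_neg (by omega : ¬ 1266 ≤ 384 + k)]; simp
  have e3 : ∀ k ∈ range 8, (w (384 + (882 + k)) : ℤ) * xrs7 x (384 + (882 + k)) = 2 * xrs7 x (1266 + k) := fun k _ => by
    simp only [hw, if_neg (by omega : ¬ 384 + (882 + k) < 384), if_pos (by omega : 1266 ≤ 384 + (882 + k))]
    rw [show 384 + (882 + k) = 1266 + k by omega]; push_cast; ring
  rw [sum_congr rfl e1, sum_congr rfl e2, sum_congr rfl e3, sum_const_zero, zero_add, mul_sum]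

/-! ## Cells: the six tangent rows through a rank-one class -/

set_option maxRecDepth 100000 in
set_option maxHeartbeats 8000000 in
/-- Packed check of the cell identity, cells with `w < 4`. -/
theorem cellVecs7_ok_lo : ∀ w x : Fin 8, w.val < 4 →
    wvec7 (fun r => if r < 384 ∧ p7 w.val x.val ∈ rowList7 r then 1 else 0)
      = ((List.range 400).map fun j =>
          ((if isInv7 j = true ∧ perm7 j x.val = w.val then 1 else 0) + (if j = p7 w.val x.val then 6 else 0)) * 2 ^ (24 * j)).sum := by
  decide +kernel

set_option maxRecDepth 100000 in
set_option maxHeartbeats 8000000 in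
/-- Packed check of the cell identity, cells with `4 ≤ w`. -/
theorem cellVecs7_ok_hi : ∀ w x : Fin 8, 4 ≤ w.val →
    wvec7 (fun r => if r < 384 ∧ p7 w.val x.val ∈ rowList7 r then 1 else 0)
      = ((List.range 400).map fun j =>
          ((if isInv7 j = true ∧ perm7 j x.val = w.val then 1 else 0) + (if j = p7 w.val x.val then 6 else 0)) * 2 ^ (24 * j)).sum := by
  decide +kernel

/-- The cells `p7 w x` are rank-one (non-invertible) classes. -/
theorem p7_not_inv : ∀ w x : Fin 8, isInv7 (p7 w.val x.val) = false := by decide +kernel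

/-- **Cell identity.** For `w, i < 8`: the tangent rows through `p7 w i` sum to the invertible classes `g < 400` with
`perm7 g i = w` plus six times `x (p7 w i)`; and there are exactly six such rows. -/
theorem cell_sum7 (x : ℕ → ℕ) {w i : ℕ} (hw : w < 8) (hi : i < 8) :
    ∑ r ∈ range 1274, ((if r < 384 ∧ p7 w i ∈ rowList7 r then 1 else 0 : ℕ) : ℤ) * xrs7 x r
      = ∑ g ∈ (range 400).filter (fun g => isInv7 g = true ∧ perm7 g i = w), (x g : ℤ) + 6 * (x (p7 w i) : ℤ)
    ∧ wcoef7 (fun r => if r < 384 ∧ p7 w i ∈ rowList7 r then 1 else 0) (p7 w i) = 6 := by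
  set cw : ℕ → ℕ := fun r => if r < 384 ∧ p7 w i ∈ rowList7 r then 1 else 0 with hcw
  set F : ℕ → ℕ := fun j => (if isInv7 j = true ∧ perm7 j i = w then 1 else 0) + (if j = p7 w i then 6 else 0) with hF
  have hvec : wvec7 cw = ((List.range 400).map fun j => F j * 2 ^ (24 * j)).sum := by
    by_cases h4 : w < 4
    · exact cellVecs7_ok_lo ⟨w, hw⟩ ⟨i, hi⟩ h4
    · exact cellVecs7_ok_hi ⟨w, hw⟩ ⟨i, hi⟩ (by show 4 ≤ w; omega)
  have hpk : pack24 (wcoef7 cw) 400 = pack24 F 400 := by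
    rw [← wvec7_eq_pack24, hvec]; unfold pack24; rw [list_sum_range_map]
  have hcwle : ∀ r, cw r ≤ 1 := fun r => by simp only [hcw]; split_ifs <;> omega
  have hFle : ∀ j, F j ≤ 7 := fun j => by simp only [hF]; split_ifs <;> omega
  have hcoef : ∀ j < 400, wcoef7 cw j = F j := fun j hj =>
    pack24_inj (fun k _ => lt_of_le_of_lt (wcoef7_le hcwle k) (by norm_num))
      (fun k _ => lt_of_le_of_lt (hFle k) (by norm_num)) hpk hj
  have hp := p7_lt ⟨w, hw⟩ ⟨i, hi⟩
  refine ⟨?_, ?_⟩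
  · have h1 : ∑ j ∈ range 400, (wcoef7 cw j : ℤ) * (x j : ℤ)
        = ∑ j ∈ range 400, ((if isInv7 j = true ∧ perm7 j i = w then (x j : ℤ) else 0) + (if j = p7 w i then 6 * (x j : ℤ) else 0)) := by
      refine sum_congr rfl fun j hj => ?_
      rw [hcoef j (mem_range.1 hj)]
      simp only [hF]
      push_cast
      split_ifs <;> ring
    have hB : ∑ j ∈ range 400, (if j = p7 w i then 6 * (x j : ℤ) else 0) = 6 * (x (p7 w i) : ℤ) := by
      rw [sum_eq_single (p7 w i)]
      · rw [if_pos rfl]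
      · intro j _ hj; rw [if_neg hj]
      · intro h; exact absurd (mem_range.2 hp) h
    have hR : ∑ g ∈ (range 400).filter (fun g => isInv7 g = true ∧ perm7 g i = w), (x g : ℤ)
        = ∑ j ∈ range 400, (if isInv7 j = true ∧ perm7 j i = w then (x j : ℤ) else 0) := sum_filter _ _
    rw [hR, sum_w_xrs7 cw x, h1, sum_add_distrib, hB]
  · rw [hcoef _ hp]
    have : isInv7 (p7 w i) = false := p7_not_inv ⟨w, hw⟩ ⟨i, hi⟩
    simp [hF, this]

/-! ## Row-plane rows and the rank-one partition -/

set_option maxRecDepth 100000 in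
/-- Packed check: row-plane row `1266 + w` lists the classes `p7 w i`, `i < 8`. -/
theorem rulVecs7_ok : ∀ w : Fin 8, rowVec7 (1266 + w.val) = ((List.range 8).map fun i => 2 ^ (24 * p7 w.val i)).sum := by
  decide +kernel

/-- **Row-plane identity.** `xrs7 x (1266 + w) = Σ_{i<8} x (p7 w i)` (`w < 8`). -/
theorem ruling_sum7 (x : ℕ → ℕ) {w : ℕ} (hw : w < 8) :
    xrs7 x (1266 + w) = ∑ i ∈ range 8, (x (p7 w i) : ℤ) := by
  have hL : ∀ a ∈ (List.range 8).map (p7 w), a < 400 := by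
    intro a ha; rw [List.mem_map] at ha; obtain ⟨i, hi, rfl⟩ := ha
    exact p7_lt ⟨w, hw⟩ ⟨i, List.mem_range.1 hi⟩
  have hpk : pack24 (cnt7 (1266 + w)) 400 = pack24 (fun j => ((List.range 8).map (p7 w)).count j) 400 := by
    rw [← rowVec7_eq_pack24 (by omega), rulVecs7_ok ⟨w, hw⟩, ← List.sum_map_pow_eq_pack24_count 400 _ hL, List.map_map]; rfl
  have hcle : ∀ j, ((List.range 8).map (p7 w)).count j ≤ 8 := fun j => le_trans List.count_le_length (by simp)
  have hcoef : ∀ j < 400, cnt7 (1266 + w) j = ((List.range 8).map (p7 w)).count j := fun j hj =>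
    pack24_inj (fun k _ => lt_of_le_of_lt (cnt7_le _ k) (by norm_num)) (fun k _ => lt_of_le_of_lt (hcle k) (by norm_num)) hpk hj
  rw [xrs7_eq_sum x (by omega : 1266 + w < 1274), sum_congr rfl fun j hj => by rw [hcoef j (mem_range.1 hj)]]
  have h := List.sum_map_eq_sum_count_smul (fun j => (x j : ℤ)) 400 ((List.range 8).map (p7 w)) hL
  rw [List.map_map, list_sum_range_map] at h
  rw [show (fun i => (x (p7 w i) : ℤ)) = ((fun j => (x j : ℤ)) ∘ p7 w) from rfl, h]
  exact sum_congr rfl fun j _ => by rw [nsmul_eq_mul]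

set_option maxRecDepth 100000 in
set_option maxHeartbeats 4000000 in
/-- Packed check: the rank-one classes `j < 400` are exactly the 64 cells `p7 w i` (as a double sum over `w, i < 8`). -/
theorem rankOneVec7_ok :
    ((List.range 400).map fun j => if isInv7 j = true then 0 else 2 ^ (24 * j)).sum
      = ((List.range 8).map fun w => ((List.range 8).map fun i => 2 ^ (24 * p7 w i)).sum).sum := by
  decide +kernel

/-- **Rank-one partition.** `Σ_{j<400, ¬inv} x j = Σ_{w<8} Σ_{i<8} x (p7 w i)`. -/
theorem rankOne_sum7 (x : ℕ → ℕ) :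
    ∑ j ∈ (range 400).filter (fun j => isInv7 j = false), (x j : ℤ) = ∑ w ∈ range 8, ∑ i ∈ range 8, (x (p7 w i) : ℤ) := by
  set F : ℕ → ℕ := fun j => if isInv7 j = true then 0 else 1 with hF
  set C : ℕ → ℕ := fun j => ∑ w ∈ range 8, ((List.range 8).map (p7 w)).count j with hC
  have hL : ∀ w < 8, ∀ a ∈ (List.range 8).map (p7 w), a < 400 := by
    intro w hw a ha; rw [List.mem_map] at ha; obtain ⟨i, hi, rfl⟩ := ha
    exact p7_lt ⟨w, hw⟩ ⟨i, List.mem_range.1 hi⟩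
  have hpk : pack24 F 400 = pack24 C 400 := by
    have h1 : ((List.range 400).map fun j => if isInv7 j = true then 0 else 2 ^ (24 * j)).sum = pack24 F 400 := by
      unfold pack24; rw [list_sum_range_map]; exact sum_congr rfl fun j _ => by simp only [hF]; split_ifs <;> simp
    have h2 : ((List.range 8).map fun w => ((List.range 8).map fun i => 2 ^ (24 * p7 w i)).sum).sum = pack24 C 400 := by
      rw [hC, pack24_sum, list_sum_range_map]
      refine sum_congr rfl fun w hw => ?_
      rw [← List.sum_map_pow_eq_pack24_count 400 _ (hL w (mem_range.1 hw)), List.map_map]; rfl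
    rw [← h1, ← h2]; exact rankOneVec7_ok
  have hFle : ∀ j, F j ≤ 1 := fun j => by simp only [hF]; split_ifs <;> omega
  have hCle : ∀ j, C j ≤ 8 * 8 := fun j => by
    simp only [hC]
    calc ∑ w ∈ range 8, ((List.range 8).map (p7 w)).count j ≤ ∑ w ∈ range 8, 8 :=
          sum_le_sum fun w _ => le_trans List.count_le_length (by simp)
      _ = 8 * 8 := by simp
  have hcoef : ∀ j < 400, F j = C j := fun j hj =>
    pack24_inj (fun k _ => lt_of_le_of_lt (hFle k) (by norm_num)) (fun k _ => lt_of_le_of_lt (hCle k) (by norm_num)) hpk hj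
  -- left side as an F-weighted sum
  have hl : ∑ j ∈ (range 400).filter (fun j => isInv7 j = false), (x j : ℤ) = ∑ j ∈ range 400, (F j : ℤ) * (x j : ℤ) := by
    rw [sum_filter]
    refine sum_congr rfl fun j _ => ?_
    simp only [hF]
    by_cases h : isInv7 j = true
    · rw [if_pos h, if_neg (by rw [h]; simp)]; simp
    · rw [if_neg h, if_pos (by simpa using h)]; simp
  rw [hl, sum_congr rfl fun j hj => by rw [hcoef j (mem_range.1 hj)]]
  simp only [hC]
  push_cast
  rw [sum_congr rfl fun j _ => sum_mul _ _ _, sum_comm]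
  refine sum_congr rfl fun w hw => ?_
  have h := List.sum_map_eq_sum_count_smul (fun j => (x j : ℤ)) 400 ((List.range 8).map (p7 w)) (hL w (mem_range.1 hw))
  rw [List.map_map, list_sum_range_map] at h
  rw [show (fun i => (x (p7 w i) : ℤ)) = ((fun j => (x j : ℤ)) ∘ p7 w) from rfl, h]
  exact sum_congr rfl fun j _ => by rw [nsmul_eq_mul]


end Summit.MatrixMultiplication.OmegaCensus.SmallFormats
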